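import Literature.AlgebraicGeometry.ShimuraVarieties.UnitaryShimuraComplexRecordSystemIso
import Literature.AlgebraicGeometry.ShimuraVarieties.UnitaryShimuraLevelFibres
import Literature.AlgebraicGeometry.Motives.SepQuotientComparisonComplex
import HarnessLib

/-!
# `Sc.Mc_K = Sc.Mc_N/(K/N)` for a COMPLEX record system of the compact unitary Shimura surface, and separated quotients of
# coproducts summand-by-orbit ([Deligne1979ShimuraVarieties] 2.7.1 (c), 2.1.2–2.1.4; [MumfordAV1970] §7 Remark)

Topic `AlgebraicGeometry/ShimuraVarieties`; namespaces `Literature.AlgebraicGeometry.Motives` (§1) and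
`Literature.AlgebraicGeometry.ShimuraVarieties.UnitaryCanonicalModel` (§2).  THEOREMS ONLY: no definition, no named fact, no
instance, no `sorry`.  Cell hodgecm-mathlib (D-0151), hDel line I-1′, receptacle v4 «Q-architecture», the two quotient lemmas
behind leaf Q4 (`UnitaryAuxiliaryExtLevelQuotient`).  HC_CM is proved only modulo the 7 printed citations until rung 0 closes;
nothing here touches a floor binder.

* §1 `Motives.isSepQuotient_sigmaDesc` — automorphisms `A γ` of a constant coproduct `∐_{i : I} Y` permuting the summands along
  `σ γ : I → I` and acting on each by `ρ γ : Y ≅ Y`; if the fibres of the onto map `π : I → J` are the `σ`-orbits and the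
  `σ`-stabiliser of every index realises every `ρ γ`, then for every separated quotient `q : Y ⟶ Z` by the `ρ γ`
  (`Motives.IsSepQuotient`, [MumfordAV1970] §7 Remark) the morphism `∐_I Y ⟶ ∐_J Z`, summand `i` by `q` onto summand `π i`,
  is a separated quotient by the `A γ` (read summand-by-orbit; `Sigma.desc`/`Sigma.hom_ext`).
* §2 `ComplexRecordSystem.isLevelQuotient` — **[Deligne1979ShimuraVarieties] 2.7.1 (c) OVER `ℂ` for ANY complex record system
  `Sc`** ([Milne2005ShimuraVarieties] Rem. 5.29 (c) «`S_K` is the quotient of `S_{K′}` by the action of `K/K′`»): for small levels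
  `N ≤ K`, `N` normal in `K`, `K` acts on `Sc.Mc_N` by the complex Hecke translates `[z, aN] ↦ [z, ak⁻¹N]`
  (★ `ComplexRecord.exists_heckeComplex`, a homomorphism by ★ `hecke_unique`), the action kills `N`, and `Sc.Mc_N ⟶ Sc.Mc_K` is
  the quotient for separated test objects.  This is part (C) of ★ `RecordSystem.isLevelQuotient`
  (`UnitaryShimuraLevelQuotientHolds`) re-run DIRECTLY on `Sc` — no rational model, none of `hpos/hanis/htf`, and NOT via the named
  fact `exists_recordSystem` (kernel-equivalent to F1, which I-1′ implies: circular under `HDel_proof`): Mumford's quotient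
  `Sc.Mc_N/(K/N)` (★ `Motives.autQuotient`), the comparison morphism to `Sc.Mc_K` is bijective on complex points by the
  double-coset bookkeeping `Sh_K(ℂ) = Sh_N(ℂ)/(K/N)` (★ `ShimuraSet.mk_eq_mk_iff_exists_mem`), hence an isomorphism by Zariski's
  Main Theorem over the ball-quotient pieces (★ `isIso_of_bijective_of_isColimit_cofan`), so the transition morphism is a
  separated quotient (★ `isSepQuotient_of_isIso_desc`).

## References
* [Deligne1979ShimuraVarieties] P. Deligne, *Variétés de Shimura*, PSPM XXXIII.2 (1979): 2.1.2–2.1.4 (PDF p. 24 of Milne's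
  translation), 2.7.1 (b)–(c) (PDF p. 47 L26–38).
* [Milne2005ShimuraVarieties] J. S. Milne, *Introduction to Shimura varieties* (2005): Lemma 5.13 p. 57, Rem. 5.29 (c) p. 65,
  §13 p. 118 L21–26.
* [MumfordAV1970] D. Mumford, *Abelian Varieties* (1970), §7 Thm. p. 66 and Remark (categorical quotient by a finite group).
* [Springer1998] T. A. Springer, *Linear Algebraic Groups*, Thm. 5.2.8.
-/

set_option autoImplicit false

noncomputable section

open Function MulAction Topology NumberField CategoryTheory CategoryTheory.Limits Matrix AlgebraicGeometry
open scoped Matrix ComplexOrder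
open Literature.AlgebraicGeometry.Motives
open Literature.NumberTheory.Automorphic Literature.NumberTheory.Automorphic.UnitaryGroup
open Literature.NumberTheory.Automorphic.Liu2021.AppendixC (C5.OpenCompactSubgroup C5.SmallLevel)
open Literature.Geometry.ComplexHyperbolic Literature.Geometry.ComplexHyperbolic.BallModel
open Literature.NumberTheory.Automorphic.ShimuraDissection

/-! ## §1 The categorical lemma: a separated quotient of a coproduct, summand-by-orbit -/

namespace Literature.AlgebraicGeometry.Motives

universe u

section SigmaQuotient

variable {k : Type u} [Field k] {Y Z : SchemeOver k} {I J : Type} {Γ : Type*}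

/-- **A separated quotient of a constant coproduct, summand-by-orbit** ([MumfordAV1970] §7 Remark «`(Y, π)` is a categorical
quotient», applied summand by summand).  Data: automorphisms `A γ` of `∐_{i : I} Y` with `ι_i ≫ A γ = ρ γ ≫ ι_{σ γ i}` (they
permute the summands along `σ γ` and act on each by `ρ γ : Y ≅ Y`); an onto map `π : I → J` whose fibres are the `σ`-orbits
(`horb`); the `σ`-stabiliser of each index realises every `ρ γ` (`hstab`); a separated quotient `q : Y ⟶ Z` by the `ρ γ`.
Conclusion: `∐_I Y ⟶ ∐_J Z`, summand `i` by `q` onto summand `π i`, is a separated quotient by the `A γ`: invariance is read on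
each summand; an `A`-invariant `u : ∐_I Y ⟶ W` has `ρ`-invariant components `ι_i ≫ u` (by `hstab`), which factor uniquely through
`q`, the factors depending only on `π i` (by `horb` and the invariance of `q`), and glue along `∐_J Z` (`Sigma.desc`, `Sigma.hom_ext`).
[cite: MumfordAV1970, §7 Thm. p. 66 (Remark)] [cite: Deligne1979ShimuraVarieties, 2.1.2–2.1.4 (PDF p. 24 of Milne's translation)] -/
theorem isSepQuotient_sigmaDesc (ρ : Γ → (Y ≅ Y)) (σ : Γ → I → I) (A : Γ → ((∐ fun _ : I => Y) ≅ (∐ fun _ : I => Y)))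
    (hA : ∀ (γ : Γ) (i : I),
      Sigma.ι (fun _ : I => Y) i ≫ (A γ).hom = (ρ γ).hom ≫ Sigma.ι (fun _ : I => Y) (σ γ i))
    (π : I → J) (hπ : Function.Surjective π) (horb : ∀ i i' : I, π i = π i' ↔ ∃ γ : Γ, σ γ i = i')
    (hstab : ∀ (γ : Γ) (i : I), ∃ γ' : Γ, σ γ' i = i ∧ ρ γ' = ρ γ)
    {q : Y ⟶ Z} (hq : IsSepQuotient ρ q) :
    IsSepQuotient A (Sigma.desc fun i : I => q ≫ Sigma.ι (fun _ : J => Z) (π i)) := by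
  classical
  have hπσ : ∀ (γ : Γ) (i : I), π (σ γ i) = π i := fun γ i => ((horb i (σ γ i)).2 ⟨γ, rfl⟩).symm
  refine ⟨fun γ => ?_, fun W u hW hu => ?_⟩
  · -- invariance, summand by summand
    refine Sigma.hom_ext _ _ fun i => ?_
    rw [← Category.assoc, hA, Category.assoc, Sigma.ι_desc, Sigma.ι_desc, ← Category.assoc, hq.1 γ, hπσ]
  · -- the components of an invariant `u` are `ρ`-invariant
    let uI : I → (Y ⟶ W) := fun i => Sigma.ι (fun _ : I => Y) i ≫ u
    have huI : ∀ (γ : Γ) (i : I), (ρ γ).hom ≫ uI (σ γ i) = uI i := fun γ i => by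
      change (ρ γ).hom ≫ Sigma.ι (fun _ : I => Y) (σ γ i) ≫ u = Sigma.ι (fun _ : I => Y) i ≫ u
      rw [← Category.assoc, ← hA, Category.assoc, hu γ]
    have hinv : ∀ (i : I) (γ : Γ), (ρ γ).hom ≫ uI i = uI i := fun i γ => by
      obtain ⟨γ', hγ'i, hγ'⟩ := hstab γ i
      have h := huI γ' i
      rw [hγ'i, hγ'] at h
      exact h
    -- factor each component through `q`
    have hex : ∀ i : I, ∃ f : Z ⟶ W, q ≫ f = uI i ∧ ∀ f' : Z ⟶ W, q ≫ f' = uI i → f' = f := fun i => by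
      obtain ⟨f, hf, hfu⟩ := hq.2 W (uI i) hW (hinv i)
      exact ⟨f, hf, hfu⟩
    choose fbar hfbar huniq using hex
    -- the factors depend only on the orbit
    have hcompat : ∀ i i' : I, π i = π i' → fbar i = fbar i' := fun i i' hii' => by
      obtain ⟨γ, rfl⟩ := (horb i i').1 hii'
      refine (huniq i (fbar (σ γ i)) ?_).symm
      rw [← huI γ i, ← hfbar (σ γ i), ← Category.assoc, hq.1 γ]
    -- glue along `∐_J Z` through a section of `π`
    obtain ⟨s, hs⟩ := hπ.hasRightInverse
    refine ⟨Sigma.desc fun j : J => fbar (s j), ?_, fun v hv => ?_⟩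
    · refine Sigma.hom_ext _ _ fun i => ?_
      rw [← Category.assoc, Sigma.ι_desc, Category.assoc, Sigma.ι_desc, hcompat (s (π i)) i (hs (π i)), hfbar]
    · refine Sigma.hom_ext _ _ fun j => ?_
      obtain ⟨i, rfl⟩ := hπ j
      rw [Sigma.ι_desc, hcompat (s (π i)) i (hs (π i))]
      refine huniq i _ ?_
      rw [← Category.assoc, ← Sigma.ι_desc (fun i : I => q ≫ Sigma.ι (fun _ : J => Z) (π i)) i, Category.assoc, hv]

end SigmaQuotient

end Literature.AlgebraicGeometry.Motives

namespace Literature.AlgebraicGeometry.ShimuraVarieties.UnitaryCanonicalModel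

variable {L : Type} [Field L] [NumberField L] [IsCMField L] {H : Matrix (Fin 3) (Fin 3) L}
  {τ : L →+* ℂ} {T : GL (Fin 3) ℂ} {hT : formCongr (starRingEnd ℂ) T (H.map τ) = BallModel.J}
  {K₀ : C5.OpenCompactSubgroup ↥(finAdelic (↥(maximalRealSubfield L)) L (IsCMField.complexConj L) 3 H)}

/-! ## §2 [Deligne1979ShimuraVarieties] 2.7.1 (c) over `ℂ` for a complex record system: `Sc.Mc_K = Sc.Mc_N/(K/N)` -/

set_option maxHeartbeats 1600000 in -- large adelic / Shimura-set terms (as the record version `RecordSystem.isLevelQuotient`)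
/-- **[Deligne1979ShimuraVarieties] 2.7.1 (c) OVER `ℂ`, for any complex record system: `Sc.Mc_K = Sc.Mc_N/(K/N)`.**  For small
levels `N ≤ K ≤ K₀` with `k⁻¹Nk ⊆ N` for all `k ∈ K`: there is a homomorphism `act : K → Aut_ℂ(Sc.Mc_N)` with `act k` the complex
Hecke translate `[z, aN] ↦ [z, ak⁻¹N]` ([Milne2005ShimuraVarieties] §13 p. 118 L25–26, ★ `ComplexRecord.exists_heckeComplex`; a right
action written as automorphisms, a homomorphism by ★ `hecke_unique`), `act k = 1` for `k ∈ N`, and the transition morphism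
`Sc.Mc_N ⟶ Sc.Mc_K` is the quotient of `Sc.Mc_N` by the `act k` for separated test objects (`Motives.IsSepQuotient`).  Proof = part
(C) of ★ `RecordSystem.isLevelQuotient` run directly over `ℂ`: `K` acts through the finite `Δ = K/N`; Mumford's quotient
`π : Sc.Mc_N ⟶ Sc.Mc_N/Δ` (★ `autQuotient`) and the comparison `r : Sc.Mc_N/Δ ⟶ Sc.Mc_K`; `r` is bijective on complex points
(`π(ℂ)` onto, ★ `map_mk_surjective`; `[z, aK] = [z′, a′K] ⇒ [z′, a′N] = [z, akN]`, ★ `ShimuraSet.mk_eq_mk_iff_exists_mem`), `Sc.Mc_N/Δ`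
is proper and reduced, `Sc.Mc_K` is the coproduct of smooth projective ball quotients (field `pieces`), so `r` is an isomorphism
(★ `isIso_of_bijective_of_isColimit_cofan`) and the transition morphism is a separated quotient (★ `isSepQuotient_of_isIso_desc`).
No rational model and no named fact is used.
[cite: Deligne1979ShimuraVarieties, 2.7.1 (b)–(c) (PDF p. 47 L26–38) and 2.1.2–2.1.4 (PDF p. 24)]
[cite: Milne2005ShimuraVarieties, Rem. 5.29 (c) p. 65; Lemma 5.13 p. 57; §13 p. 118 L21–26] [cite: MumfordAV1970, §7 Thm. p. 66 (Remark)] -/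
theorem ComplexRecordSystem.isLevelQuotient (Sc : ComplexRecordSystem L H τ T hT K₀) {N K : C5.SmallLevel K₀} (h : N ≤ K)
    (hNK : ∀ k ∈ K.1.1, ∀ n ∈ N.1.1, k⁻¹ * n * k ∈ N.1.1) :
    ∃ act : ↥K.1.1 →* Aut (Sc.Mc.obj N),
      (∀ (k : ↥K.1.1) (z : Ball) (a : finAdelic (↥(maximalRealSubfield L)) L (IsCMField.complexConj L) 3 H),
          AlgPoints.map (act k).hom ((Sc.pts N).symm (ShimuraSet.mk L H τ T hT N.1.1 z a)) =
            (Sc.pts N).symm (ShimuraSet.mk L H τ T hT N.1.1 z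
              (a * ((k : finAdelic (↥(maximalRealSubfield L)) L (IsCMField.complexConj L) 3 H))⁻¹))) ∧
        (∀ k : ↥K.1.1, (k : finAdelic (↥(maximalRealSubfield L)) L (IsCMField.complexConj L) 3 H) ∈ N.1.1 → act k = 1) ∧
        Motives.IsSepQuotient (fun k => act k) (Sc.Mc.map (homOfLE h)) := by
  classical
  -- notation
  let G := finAdelic (↥(maximalRealSubfield L)) L (IsCMField.complexConj L) 3 H
  let Kg : Subgroup G := K.1.1
  let Ng : Subgroup Kg := N.1.1.subgroupOf K.1.1
  have hmemNg : ∀ x : Kg, x ∈ Ng ↔ (x : G) ∈ N.1.1 := fun x => Subgroup.mem_subgroupOf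
  haveI hNn : Ng.Normal := ⟨fun n hn' g => by
    rw [hmemNg] at hn' ⊢
    have h1 := hNK ((g⁻¹ : Kg) : G) (g⁻¹).2 (n : G) hn'
    simpa only [Subgroup.coe_inv, inv_inv, Subgroup.coe_mul] using h1⟩
  haveI : CompactSpace Kg := isCompact_iff_compactSpace.1 K.1.2.2
  have hNo : IsOpen (Ng : Set Kg) := N.1.2.1.preimage continuous_subtype_val
  haveI : Finite (Kg ⧸ Ng) := Subgroup.quotient_finite_of_isOpen Ng hNo
  letI : Fintype (Kg ⧸ Ng) := Fintype.ofFinite _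
  have hinv : ∀ {k : G}, k ∈ K.1.1 → k⁻¹ ∈ K.1.1 := fun hk => K.1.1.inv_mem hk
  -- the point `[z, aN]` of `Sc.Mc_N`
  let P : Ball → G → ComplexPoints (Sc.Mc.obj N) := fun z a => (Sc.pts N).symm (ShimuraSet.mk L H τ T hT N.1.1 z a)
  have hP : ∀ y : ComplexPoints (Sc.Mc.obj N), ∃ z a, y = P z a := fun y => Sc.exists_eq_pts_symm_mk N y
  -- (E1) the complex Hecke translates `T_{k⁻¹}`, `k ∈ K`
  have hex : ∀ k : Kg, ∃ Tk : Sc.Mc.obj N ⟶ Sc.Mc.obj N, ∀ (z : Ball) (a : G),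
      AlgPoints.map Tk (P z a) = P z (a * (k : G)⁻¹) := fun k =>
    ComplexRecord.exists_heckeComplex (Sc.record N) (Sc.record N) ((k : G)⁻¹) fun n hn => by
      simpa only [inv_inv] using hNK _ (hinv k.2) n hn
  choose Tr hTr using hex
  have huniq : ∀ {g : G} {T₁ T₂ : Sc.Mc.obj N ⟶ Sc.Mc.obj N},
      (∀ z a, AlgPoints.map T₁ (P z a) = P z (a * g)) → (∀ z a, AlgPoints.map T₂ (P z a) = P z (a * g)) → T₁ = T₂ :=
    fun h₁ h₂ => ComplexRecord.hecke_unique (Sc.record N) (Sc.record N) h₁ h₂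
  have hTr1 : ∀ k : Kg, (k : G) ∈ N.1.1 → Tr k = 𝟙 (Sc.Mc.obj N) := fun k hk =>
    huniq (hTr k) fun z a => by
      rw [AlgPoints.map_id_apply]
      change (Sc.pts N).symm (ShimuraSet.mk L H τ T hT N.1.1 z a) =
        (Sc.pts N).symm (ShimuraSet.mk L H τ T hT N.1.1 z (a * (k : G)⁻¹))
      rw [shimuraSet_mk_mul_of_mem N.1.1 z a (N.1.1.inv_mem hk)]
  have hTrmul : ∀ a b : Kg, Tr (a * b) = Tr b ≫ Tr a := fun a b =>
    huniq (hTr (a * b)) fun z c => by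
      rw [AlgPoints.map_comp_apply, hTr b, hTr a, Subgroup.coe_mul, _root_.mul_inv_rev, mul_assoc]
  have hTrone : Tr 1 = 𝟙 (Sc.Mc.obj N) := hTr1 1 (by rw [Subgroup.coe_one]; exact N.1.1.one_mem)
  have hTT : ∀ k : Kg, Tr k ≫ Tr k⁻¹ = 𝟙 (Sc.Mc.obj N) := fun k => by rw [← hTrmul, inv_mul_cancel, hTrone]
  have hTT' : ∀ k : Kg, Tr k⁻¹ ≫ Tr k = 𝟙 (Sc.Mc.obj N) := fun k => by rw [← hTrmul, mul_inv_cancel, hTrone]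
  let act : Kg →* Aut (Sc.Mc.obj N) :=
    { toFun := fun k => ⟨Tr k, Tr k⁻¹, hTT k, hTT' k⟩
      map_one' := Iso.ext hTrone
      map_mul' := fun a b => Iso.ext (hTrmul a b) }
  have act_hom : ∀ k : Kg, (act k).hom = Tr k := fun _ => rfl
  -- it kills `N`: descend to the finite group `Δ = K/N`
  have hker1 : ∀ k : Kg, (k : G) ∈ N.1.1 → act k = 1 := fun k hk => Iso.ext (by rw [act_hom]; exact hTr1 k hk)
  have hker : ∀ n ∈ Ng, act n = 1 := fun n hn' => hker1 n ((hmemNg n).1 hn')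
  let actΔ : (Kg ⧸ Ng) →* Aut (Sc.Mc.obj N) := QuotientGroup.lift Ng act hker
  have actΔ_mk : ∀ k : Kg, actΔ (QuotientGroup.mk k) = act k := fun _ => rfl
  -- (E2) the transition morphism `p : Sc.Mc_N ⟶ Sc.Mc_K` is invariant
  let p : Sc.Mc.obj N ⟶ Sc.Mc.obj K := Sc.Mc.map (homOfLE h)
  have hp : ∀ z a, AlgPoints.map p (P z a) = (Sc.pts K).symm (ShimuraSet.mk L H τ T hT K.1.1 z a) := fun z a =>
    Sc.map_pts_symm N K (homOfLE h) z a
  have hinvK : ∀ k : Kg, (act k).hom ≫ p = p := by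
    intro k
    refine ComplexRecord.hecke_unique (Sc.record N) (Sc.record K) (g := 1) (fun z a => ?_) (fun z a => ?_)
    · change AlgPoints.map (Tr k ≫ p) (P z a) = (Sc.pts K).symm (ShimuraSet.mk L H τ T hT K.1.1 z (a * 1))
      rw [AlgPoints.map_comp_apply, hTr k, hp, mul_one, shimuraSet_mk_mul_of_mem K.1.1 z a (hinv k.2)]
    · change AlgPoints.map p (P z a) = (Sc.pts K).symm (ShimuraSet.mk L H τ T hT K.1.1 z (a * 1))
      rw [hp, mul_one]
  have hinvΔ : ∀ g : Kg ⧸ Ng, (actΔ g).hom ≫ p = p := fun g => by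
    obtain ⟨k, rfl⟩ := QuotientGroup.mk_surjective g
    exact hinvK k
  -- (E3) Mumford's quotient `Q = Sc.Mc_N/Δ` and the comparison `r : Q ⟶ Sc.Mc_K`
  have hY : IsProjectiveOver (Sc.Mc.obj N) := Sc.projective N
  have hZ : IsSeparated (Sc.Mc.obj K).hom := by
    haveI := (Sc.projective K).isProper; infer_instance
  let r := autQuotient.desc actΔ hY p hZ hinvΔ
  have hπr : autQuotient.mk actΔ hY ≫ r = p := autQuotient.mk_desc actΔ hY p hZ hinvΔ
  suffices hiso : IsIso r by
    have hq : IsSepQuotient (fun g => actΔ g) p := isSepQuotient_of_isIso_desc hY actΔ p hZ hinvΔ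
    refine ⟨act, fun k z a => ?_, hker1, ⟨fun k => hinvK k, fun W f hW hf => hq.2 W f hW fun g => ?_⟩⟩
    · change AlgPoints.map (Tr k) (P z a) = P z (a * (k : G)⁻¹)
      exact hTr k z a
    · obtain ⟨k, rfl⟩ := QuotientGroup.mk_surjective g
      exact hf k
  -- (C) instances for `Q`, `Sc.Mc_N`, `Sc.Mc_K`
  haveI := Sc.smooth N
  haveI : Smooth (Sc.Mc.obj N).hom := SmoothOfRelativeDimension.smooth 2 _
  haveI : IsReduced (Sc.Mc.obj N).left := isReduced_of_smooth_over_field (Sc.Mc.obj N).hom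
  haveI : IsReduced (autQuotient actΔ hY).left := isReduced_autQuotient_left actΔ hY
  haveI : IsProper (autQuotient actΔ hY).hom := autQuotient.isProper_hom actΔ hY
  haveI := hZ
  -- the pieces of `Sc.Mc_K`
  obtain ⟨gK, hgK, X, ι, hcol, B, hB⟩ := Sc.pieces K
  -- complex points: `π(ℂ)` is onto and `Δ`-invariant, `r ∘ π = p`
  have hcomp : ∀ y : ComplexPoints (Sc.Mc.obj N),
      AlgPoints.map r (AlgPoints.map (autQuotient.mk actΔ hY) y) = AlgPoints.map p y := fun y => by
    rw [← AlgPoints.map_comp_apply]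
    exact congrArg (fun φ => AlgPoints.map φ y) hπr
  have hπinv : ∀ (k : Kg) (y : ComplexPoints (Sc.Mc.obj N)),
      AlgPoints.map (autQuotient.mk actΔ hY) (AlgPoints.map (act k).hom y) = AlgPoints.map (autQuotient.mk actΔ hY) y :=
    fun k y => by rw [← AlgPoints.map_comp_apply, ← actΔ_mk, autQuotient.hom_mk]
  have hπsurj : Function.Surjective (AlgPoints.map (L := ℂ) (autQuotient.mk actΔ hY)) := by
    haveI := hY.isSeparated
    exact map_mk_surjective (autActionOver actΔ) (autActionOver_cover actΔ hY)
  -- `r` is bijective on complex points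
  have hbij : Function.Bijective (AlgPoints.map (L := ℂ) r) := by
    constructor
    · intro a₁ a₂ h₁₂
      obtain ⟨y₁, rfl⟩ := hπsurj a₁
      obtain ⟨y₂, rfl⟩ := hπsurj a₂
      obtain ⟨z₁, b₁, rfl⟩ := hP y₁
      obtain ⟨z₂, b₂, rfl⟩ := hP y₂
      -- `[z₁, b₁K] = [z₂, b₂K]`
      have hK : ShimuraSet.mk L H τ T hT K.1.1 z₁ b₁ = ShimuraSet.mk L H τ T hT K.1.1 z₂ b₂ := by
        have h' := h₁₂
        rw [hcomp, hcomp, hp, hp] at h'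
        exact (Sc.pts K).symm.injective h'
      -- `[z₂, b₂N] = [z₁, b₁kN] = act k⁻¹ [z₁, b₁N]` for some `k ∈ K`
      obtain ⟨k, hk, hN⟩ :=
        (ShimuraSet.mk_eq_mk_iff_exists_mem L H τ T hT (show N.1.1 ≤ K.1.1 from h) z₁ z₂ b₁ b₂).1 hK
      have hy₂ : P z₂ b₂ = AlgPoints.map (act (⟨k, hk⟩ : Kg)⁻¹).hom (P z₁ b₁) := by
        change P z₂ b₂ = AlgPoints.map (Tr (⟨k, hk⟩ : Kg)⁻¹) (P z₁ b₁)
        rw [hTr, Subgroup.coe_inv, inv_inv]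
        exact congrArg (Sc.pts N).symm hN
      rw [hy₂, hπinv]
    · intro y
      obtain ⟨z, a, rfl⟩ := Sc.exists_eq_pts_symm_mk K y
      exact ⟨AlgPoints.map (autQuotient.mk actΔ hY) (P z a), by rw [hcomp, hp]⟩
  exact isIso_of_bijective_of_isColimit_cofan r ι (fun _ => 2) (fun q => (B q).isSmoothProjective) hcol hbij

end Literature.AlgebraicGeometry.ShimuraVarieties.UnitaryCanonicalModel

end
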